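import Summits.AtomisticToContinuum.Crystallization.Theorems.FrustratedLawDichotomyCellF1Windows

/-!
# FrustratedLawDichotomy · crux `AperiodicFrustratedLawGap` (stmt-AtomisticToContinuum-27623) — class-A K-file skeleton, layer 3e:
the per-label WINDOW COLUMNS of the F1 cell as NAMED functions with the (261) hypothesis shapes (decomp-a2c hand-2 g47, structural share;
TOY 8/9 `loQ/hiQ/rloQ/rhiQ`, `hloW/hhiW`, `cls_lo_pos/cls_rlo/cls_rhi/cls_rhi_nn/cls_tau_lt`; rule G5: named columns)

For a label `m` of the F1 cell: `loF1 m = (1−3ε)·qk m/16384²`, `hiF1 m = (1+3ε)·qk m/16384²` (exact), and the dyadic brackets `rloF1 m`, `rhiF1 m`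
read from layer 3d's window table at the class key.  The facts, in exactly the shapes (261) `host_of_nearId` / `deb_of_nearId` / `nn0_of_nearId`
(and hand-1's `_Z` readings) take them: `hloW_F1`/`hhiW_F1` (definitional after layer 1 `sumSq_aF1`), and — from the ONE decided leaf test of layer 3d
transported by the hit-check — `rlo_sq_le_F1`, `hi_le_rhi_sq_F1`, `rlo_nonneg_F1`, `tau_lt_rlo_F1` (off the root), `lo_pos_F1` (off the root).
No per-label arithmetic anywhere; every column is a named `def` (rule G5).
-/

namespace Summit.AtomisticToContinuum.Crystallization.Theorems.FrustratedLawDichotomyCellF1ClassWin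

open scoped BigOperators
open Summit.AtomisticToContinuum.Crystallization.Theorems.FrustratedLawDichotomyCellBST
open Summit.AtomisticToContinuum.Crystallization.Theorems.FrustratedLawDichotomyCellF1Frame (qk qk_nonneg admL_iff)
open Summit.AtomisticToContinuum.Crystallization.Theorems.FrustratedLawDichotomyCellF1Labels (labF1 qkF qkF_eq MF1 mem_M mem_labF1 forall_M)
open Summit.AtomisticToContinuum.Crystallization.Theorems.FrustratedLawDichotomyCellF1Pos (aF1 sumSq_aF1)
open Summit.AtomisticToContinuum.Crystallization.Theorems.FrustratedLawDichotomyCellF1Windows (treeW pWin rlo rhi pWin_sound window_MF1)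

/-- lower squared-norm window of a label: `(1 − 3ε)·qk/16384²`. -/
noncomputable def loF1 (m : ℤ × ℤ × ℤ) : ℝ := (1 - 3 * (1 / 1024 : ℝ)) * ((qk m : ℝ) / 16384 ^ 2)

/-- upper squared-norm window of a label: `(1 + 3ε)·qk/16384²`. -/
noncomputable def hiF1 (m : ℤ × ℤ × ℤ) : ℝ := (1 + 3 * (1 / 1024 : ℝ)) * ((qk m : ℝ) / 16384 ^ 2)

/-- lower dyadic distance bracket of a label (from the class window table). -/
noncomputable def rloF1 (m : ℤ × ℤ × ℤ) : ℝ := rlo (treeW.findD (qkF m) 0)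

/-- upper dyadic distance bracket of a label (from the class window table). -/
noncomputable def rhiF1 (m : ℤ × ℤ × ℤ) : ℝ := rhi (treeW.findD (qkF m) 0)

/-- (hloW) `loF1 m ≤ (1 − 3ε)·Σᵢ(aF1 m)ᵢ²` — an equality in fact. -/
theorem hloW_F1 (m : ℤ × ℤ × ℤ) : loF1 m ≤ (1 - 3 * (1 / 1024 : ℝ)) * ∑ i, aF1 m i ^ 2 := by
  rw [sumSq_aF1, loF1]

/-- (hhiW) `(1 + 3ε)·Σᵢ(aF1 m)ᵢ² ≤ hiF1 m` — an equality in fact. -/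
theorem hhiW_F1 (m : ℤ × ℤ × ℤ) : (1 + 3 * (1 / 1024 : ℝ)) * ∑ i, aF1 m i ^ 2 ≤ hiF1 m := by
  rw [sumSq_aF1, hiF1]

/-- the decided window facts of a label of `MF1`, unpacked. -/
theorem window_facts {m : ℤ × ℤ × ℤ} (hm : m ∈ MF1) :
    0 ≤ rloF1 m ∧ rloF1 m ^ 2 ≤ loF1 m ∧ hiF1 m ≤ rhiF1 m ^ 2 ∧ (qk m ≠ 0 → (1 / 1024 : ℝ) < rloF1 m) := by
  have h := pWin_sound (window_MF1 m hm)
  unfold rloF1 rhiF1 loF1 hiF1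
  rw [← qkF_eq]
  exact ⟨h.1, h.2.1, h.2.2.1, h.2.2.2⟩

/-- (cls_rhi_nn) `0 ≤ rloF1 m`. -/
theorem rlo_nonneg_F1 {m : ℤ × ℤ × ℤ} (hm : m ∈ MF1) : 0 ≤ rloF1 m := (window_facts hm).1

/-- (cls_rlo) `rloF1 m ² ≤ loF1 m`. -/
theorem rlo_sq_le_F1 {m : ℤ × ℤ × ℤ} (hm : m ∈ MF1) : rloF1 m ^ 2 ≤ loF1 m := (window_facts hm).2.1

/-- (cls_rhi) `hiF1 m ≤ rhiF1 m ²`. -/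
theorem hi_le_rhi_sq_F1 {m : ℤ × ℤ × ℤ} (hm : m ∈ MF1) : hiF1 m ≤ rhiF1 m ^ 2 := (window_facts hm).2.2.1

/-- `0 ≤ rhiF1 m` (the upper numerator is a remainder `mod 65536`, hence nonnegative). -/
theorem rhi_nonneg_F1 (m : ℤ × ℤ × ℤ) : 0 ≤ rhiF1 m := by
  unfold rhiF1 rhi Summit.AtomisticToContinuum.Crystallization.Theorems.FrustratedLawDichotomyCellF1Windows.hiN
  have : (0 : ℤ) ≤ treeW.findD (qkF m) 0 % 65536 := Int.emod_nonneg _ (by norm_num)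
  positivity

/-- a nonzero label has a nonzero class key. -/
theorem qk_ne_zero_of_ne {m : ℤ × ℤ × ℤ} (hm0 : m ≠ 0) : qk m ≠ 0 := by
  intro h
  rw [Summit.AtomisticToContinuum.Crystallization.Theorems.FrustratedLawDichotomyCellF1Frame.qk_eq] at h
  apply hm0
  have h0 := mul_self_nonneg m.1; have h1 := mul_self_nonneg m.2.1; have h2 := mul_self_nonneg m.2.2
  have e0 : m.1 * m.1 = 0 := by nlinarith
  have e1 : m.2.1 * m.2.1 = 0 := by nlinarith
  have e2 : m.2.2 * m.2.2 = 0 := by nlinarith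
  exact Prod.ext (mul_self_eq_zero.mp e0) (Prod.ext (mul_self_eq_zero.mp e1) (mul_self_eq_zero.mp e2))

/-- (cls_tau_lt) off the root, `τ < rloF1 m`. -/
theorem tau_lt_rlo_F1 {m : ℤ × ℤ × ℤ} (hm : m ∈ MF1) (hm0 : m ≠ 0) : (1 / 1024 : ℝ) < rloF1 m :=
  (window_facts hm).2.2.2 (qk_ne_zero_of_ne hm0)

/-- (cls_lo_pos) off the root, `0 < loF1 m`. -/
theorem lo_pos_F1 {m : ℤ × ℤ × ℤ} (hm : m ∈ MF1) (hm0 : m ≠ 0) : 0 < loF1 m := by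
  have h1 := tau_lt_rlo_F1 hm hm0
  have h2 := rlo_sq_le_F1 hm
  nlinarith

end Summit.AtomisticToContinuum.Crystallization.Theorems.FrustratedLawDichotomyCellF1ClassWin
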